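import Literature.Probability.RandomPlanarGeometry.HexSAWSurfaceWallRenewalCensusSeven
import Literature.Probability.RandomPlanarGeometry.HexSAWSurfaceWallRenewalKendallCube
import Literature.Probability.RandomPlanarGeometry.HexSAWSurfaceWallRenewalExcessLimit
import Literature.Probability.RandomPlanarGeometry.HexSAWSurfaceWallRenewalTenThree
import Literature.Probability.RandomPlanarGeometry.HexSAWSurfaceWallRenewalEightUnique
import Literature.Probability.RandomPlanarGeometry.HexSAWSurfaceWallRenewalMean
import Literature.Probability.RandomPlanarGeometry.HexSAWSurfaceWallRenewalSixStep
import HarnessLib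

/-!
# Kesten's identity at order seven: the explicit HEAD SANDWICH on `y > μ³`
# `1 − A(y)θ₃(y)^{10} − 3^{18}y/β^{18} − 3^{20}(y + y²)/β^{20} ≤ H₇(y) ≤ 1`,
# `H₇(y) = y/β² + y/β⁶ + y/β⁸ + 3y/β^{10} + (6y + y²)/β^{12} + (15y + 3y²)/β^{14} + (38y + 11y²)/β^{16} + (34y² + y³)/β^{18} + 7y³/β^{20}`

Topic `Literature/Probability/RandomPlanarGeometry` (lane «pcv-sawmu», a-p6 g19, car «KESTEN-HEAD-SEVEN»; parents, all TREE: the census chain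
`HexSAWSurfaceWallRenewalExcessLimit` (`Λ₄ = 0`, `Λ₆ = y`, `#ipwb_n ≤ 3^n`), `…EightUnique` (`Λ₈ = y`), `…TenThree` (`Λ₁₀ = 3y`),
`…FifthExact` (`Λ₁₂ = 6y + y²`), `…SixthExact` (`Λ₁₄ = 15y + 3y²`), a-idea-1 g34's `…CensusSeven` (`Λ₁₆ = 38y + 11y²`,
`Λ₁₈ = N₉,₁y + 34y² + y³`, `Λ₂₀ = N₁₀,₁y + N₁₀,₂y² + 7y³`), `…RenewalMean` (`y/β² ≤ f₁`), and a-p6 g19's `…KendallCube` (the six-step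
tail `1 − Σ_{k≤n} f_k ≤ Aθ₃^n` on `y > μ³`)).

THE POINT.  With the six-step law (car 71) every wall-renewal class `(s, v)` with `s − v ≤ 7` is counted (cars 63–72), and the tail of Kesten's
identity `Σ_s f_s(y) = 1` beyond half-length ten is `≤ A(y)θ₃(y)^{10} = O(y^{−22/3})` by the six-step envelope (`θ₃ = μ²/y^{2/3}`).  This module
records the resulting two-sided ALGEBRAIC constraint on `β(y)²` with every constant explicit — the input from which `a₆ = 12` (`β² = y + 1/y +
1/y² + 2/y³ + 4/y⁴ + 6/y⁵ + 12/y⁶ + o(y⁻⁶)`) follows by monotone inversion of the head (exact rational arithmetic on the census gives `a₆ = 12`,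
`m₇ = 211`, `V₇ = 21`; the inversion is NOT done here):
* `sum_pwbLaw_range_eleven_le` — `y ≥ 0`: `Σ_{k ≤ 10} f_k(y) ≤ H₇(y) + 3^{18}y/β^{18} + 3^{20}(y + y²)/β^{20}` (exact classes + the crude count
  `#ipwb_n ≤ 3^n` on the three uncounted classes `(9,1)`, `(10,1)`, `(10,2)`);
* `head_le_sum_pwbLaw_range_eleven` — `y > 0`: `H₇(y) ≤ Σ_{k ≤ 10} f_k(y)` (uncounted classes dropped; `y/β² ≤ f₁`);
* `sum_pwbLaw_range_le_one_of_cube_lt` — `y > μ³`: `Σ_{k ≤ n} f_k(y) ≤ 1`;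
* ★ `kesten_head_seven_sandwich_of_cube_lt` — `y > μ³`: `1 − Aθ₃^{10} − 3^{18}y/β^{18} − 3^{20}(y + y²)/β^{20} ≤ H₇(y) ≤ 1`,
  `A = (μ² + y^{2/3}/μ²)θ₃/(1 − θ₃)`.

ED.2 (ERRATUM + SHARPENING).  The tail at `n = 10` is `Aθ₃^{10} ≍ y^{−20/3}`, which is NOT `o(y^{−7})` (the sentence «`O(y^{−22/3})`» above
is off by one step): it pins `β²` through `a₅` only.  §4 below adds the order-SEVEN-sharp sandwich with the tail taken at `n = 11`
(`Aθ₃^{11} ≍ y^{−22/3} = o(y^{−7})`) and the whole uncounted block `k = 11` bounded crudely (`visits ≤ 3` on `ipwb 22` by the six-step law,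
`#ipwb₂₂ ≤ 3^{22}`): `kesten_head_seven_sandwich_sharp_of_cube_lt` — THIS is the input that determines `a₆`.

HONEST LABEL.  LANE LEMMA (assembly input for «A6-EXACT»), DERIVED from the landed census and Kesten's relation [MadrasSlade1993, §4.2, (4.2.2),
(4.2.4), Theorem 4.2.2 (pp. 91–92)], [Kesten1963SAW, §4]; the surface model [BeatonBousquetMelouDeGierDuminilCopinGuttmann2014, §3.1 (arXiv v5 p. 8)],
[HammersleyTorrieWhittington1982, §2].  NOT CLAIMED: the inversion (`a₆ = 12`), `m₇`, `V₇`; anything for `y ≤ μ³`.  No definitions; two private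
[folklore] twins of `HexSAWSurfaceWallRateExponentPinch`'s private two-step classification.
-/

noncomputable section

open Finset Filter
open Literature.Probability.LatticeModels
open _root_.Topology

namespace Literature.Probability.RandomPlanarGeometry.SAW.HexBW.Wall

variable {y : ℝ}

/-! ## 0. Private helpers -/

/-- [folklore] The only positive wall bridge of length `2` is the straight walk (copied from the private
`HexSAWSurfaceWallRateExponentPinch.pwb_two_subset_ep`). [cite: BeatonBousquetMelouDeGierDuminilCopinGuttmann2014, §3.1 (arXiv v5 p. 8)] -/
private theorem pwb_two_subset_khs : pwb 2 ⊆ {Zd.straightWalk 2 2} := by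
  intro ω hω
  rw [Finset.mem_singleton]
  obtain ⟨hwbr, hbr⟩ := mem_pwb.1 hω
  obtain ⟨harch, -⟩ := mem_wbr.1 hwbr
  obtain ⟨hhpw, -, h21⟩ := mem_archs.1 harch
  obtain ⟨hsaw, -⟩ := mem_hpw.1 hhpw
  obtain ⟨h0, hend, hbw, -⟩ := mem_saws_iff.1 hsaw
  have h00 : ω 0 0 = 0 := by simp [h0]
  have h01 : ω 0 1 = 0 := by simp [h0]
  have hs0 : brickWallGraph.Adj (ω 0) (ω 1) := hbw 0 (by norm_num)
  have hs1 : brickWallGraph.Adj (ω 1) (ω 2) := hbw 1 (by norm_num)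
  rw [brickWallGraph_adj_coord] at hs0 hs1
  have hb1 : ω 0 0 < ω 1 0 ∧ ω 1 0 ≤ ω 2 0 := hbr 1 le_rfl (by norm_num)
  have h10 : ω 1 0 = 1 := by omega
  have h11 : ω 1 1 = 0 := by omega
  have h20 : ω 2 0 = 2 := by omega
  funext i
  have hX : ω i 0 = ((min i 2 : ℕ) : ℤ) := by
    rcases Nat.lt_or_ge i 2 with hi | hi
    · interval_cases i
      · simp [h00]
      · simp [h10]
    · rw [hend i hi, min_eq_right hi, h20]; norm_num
  have hY : ω i 1 = 0 := by
    rcases Nat.lt_or_ge i 2 with hi | hi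
    · interval_cases i
      · exact h01
      · exact h11
    · rw [hend i hi, h21]
  funext j
  fin_cases j
  · simpa [straightWalk_apply_zero] using hX
  · simpa [straightWalk_apply_one] using hY

/-- [folklore] `f₁(y) ≤ y/β(y)²` (copied from the private `HexSAWSurfaceWallRateExponentPinch.pwbLaw_one_le_div_ep`).
[cite: MadrasSlade1993, §4.2, Theorem 4.2.2(b) (pp. 91–92)] -/
private theorem pwbLaw_one_le_div_khs (hy : 0 ≤ y) : pwbLaw y 1 ≤ y / wallRate y ^ 2 := by
  have hv : visits 2 (Zd.straightWalk 2 2) = 1 := (straightWalk_mem_pwb 1).2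
  have hP : PWB 2 y ≤ y := by
    unfold PWB
    calc ∑ ω ∈ pwb 2, y ^ visits 2 ω ≤ ∑ ω ∈ ({Zd.straightWalk 2 2} : Finset (ℕ → Site 2)), y ^ visits 2 ω :=
          Finset.sum_le_sum_of_subset_of_nonneg pwb_two_subset_khs (fun _ _ _ => pow_nonneg hy _)
      _ = y := by rw [Finset.sum_singleton, hv, pow_one]
  show IPWB 2 y / wallRate y ^ 2 ≤ y / wallRate y ^ 2
  exact div_le_div_of_nonneg_right ((IPWB_le_PWB 2 hy).trans hP) (pow_pos (wallRate_pos y) 2).le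

/-- [folklore] A class count is at most `3^n`: `#((ipwb n).filter p) ≤ 3^n`. [cite: MadrasSlade1993, §1.2, (1.2.16) (p. 11)] -/
private theorem card_filter_ipwb_le_khs (n : ℕ) (p : (ℕ → Site 2) → Prop) [DecidablePred p] :
    (#((ipwb n).filter p) : ℝ) ≤ 3 ^ n :=
  le_trans (by exact_mod_cast Finset.card_filter_le _ _) (card_ipwb_le_three_pow n)

/-- [folklore] `f_k(y) = Λ_{2k}(y)/β(y)^{2k}` with the length as a numeral. [cite: MadrasSlade1993, §4.2, (4.2.2)] -/
private theorem pwbLaw_eq_khs (k : ℕ) {m : ℕ} (hm : m = 2 * k) : pwbLaw y k = IPWB m y / wallRate y ^ m := by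
  rw [pwbLaw, hm]

/-! ## 1. The head from above: exact classes plus the crude count on the three uncounted classes -/

/-- `Σ_{k ≤ 10} f_k(y) ≤ H₇(y) + 3^{18}y/β^{18} + 3^{20}(y + y²)/β^{20}` for `y ≥ 0`.
[cite: MadrasSlade1993, §4.2, (4.2.2), (4.2.4) (p. 91)] -/
theorem sum_pwbLaw_range_eleven_le (hy : 0 ≤ y) :
    ∑ k ∈ range 11, pwbLaw y k ≤
      y / wallRate y ^ 2 + y / wallRate y ^ 6 + y / wallRate y ^ 8 + 3 * y / wallRate y ^ 10 +
        (6 * y + y ^ 2) / wallRate y ^ 12 + (15 * y + 3 * y ^ 2) / wallRate y ^ 14 + (38 * y + 11 * y ^ 2) / wallRate y ^ 16 +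
        (3 ^ 18 * y + 34 * y ^ 2 + y ^ 3) / wallRate y ^ 18 + (3 ^ 20 * y + 3 ^ 20 * y ^ 2 + 7 * y ^ 3) / wallRate y ^ 20 := by
  classical
  have hβ := wallRate_pos y
  have e0 : pwbLaw y 0 = 0 := pwbLaw_zero
  have e2 : pwbLaw y 2 = 0 := by rw [pwbLaw_eq_khs 2 (m := 4) rfl, IPWB_four rfl, zero_div]
  have e3 : pwbLaw y 3 = y / wallRate y ^ 6 := by rw [pwbLaw_eq_khs 3 (m := 6) rfl, IPWB_six rfl]
  have e4 : pwbLaw y 4 = y / wallRate y ^ 8 := by rw [pwbLaw_eq_khs 4 (m := 8) rfl, IPWB_eight_eq rfl]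
  have e5 : pwbLaw y 5 = 3 * y / wallRate y ^ 10 := by rw [pwbLaw_eq_khs 5 (m := 10) rfl, IPWB_ten_eq rfl]
  have e6 : pwbLaw y 6 = (6 * y + y ^ 2) / wallRate y ^ 12 := by rw [pwbLaw_eq_khs 6 (m := 12) rfl, IPWB_twelve_eq_six rfl]
  have e7 : pwbLaw y 7 = (15 * y + 3 * y ^ 2) / wallRate y ^ 14 := by rw [pwbLaw_eq_khs 7 (m := 14) rfl, IPWB_fourteen_eq_fifteen rfl]
  have e8 : pwbLaw y 8 = (38 * y + 11 * y ^ 2) / wallRate y ^ 16 := by rw [pwbLaw_eq_khs 8 (m := 16) rfl, IPWB_sixteen_eq_thirtyEight rfl]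
  have e9 : pwbLaw y 9 ≤ (3 ^ 18 * y + 34 * y ^ 2 + y ^ 3) / wallRate y ^ 18 := by
    rw [pwbLaw_eq_khs 9 (m := 18) rfl, IPWB_eighteen_eq rfl]
    refine div_le_div_of_nonneg_right ?_ (pow_pos hβ 18).le
    have hN := mul_le_mul_of_nonneg_right (card_filter_ipwb_le_khs 18 (fun ω => visits 18 ω = 1)) hy
    linarith
  have e10 : pwbLaw y 10 ≤ (3 ^ 20 * y + 3 ^ 20 * y ^ 2 + 7 * y ^ 3) / wallRate y ^ 20 := by
    rw [pwbLaw_eq_khs 10 (m := 20) rfl, IPWB_twenty_eq rfl]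
    refine div_le_div_of_nonneg_right ?_ (pow_pos hβ 20).le
    have hN1 := mul_le_mul_of_nonneg_right (card_filter_ipwb_le_khs 20 (fun ω => visits 20 ω = 1)) hy
    have hN2 := mul_le_mul_of_nonneg_right (card_filter_ipwb_le_khs 20 (fun ω => visits 20 ω = 2)) (pow_nonneg hy 2)
    linarith
  have e1 := pwbLaw_one_le_div_khs hy
  simp only [Finset.sum_range_succ, Finset.sum_range_zero, e0, e2, e3, e4, e5, e6, e7, e8]
  linarith

/-! ## 2. The head from below: uncounted classes dropped -/

/-- `H₇(y) ≤ Σ_{k ≤ 10} f_k(y)` for `y > 0`. [cite: MadrasSlade1993, §4.2, (4.2.2), (4.2.4) (p. 91)] -/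
theorem head_le_sum_pwbLaw_range_eleven (hy : 0 < y) :
    y / wallRate y ^ 2 + y / wallRate y ^ 6 + y / wallRate y ^ 8 + 3 * y / wallRate y ^ 10 +
        (6 * y + y ^ 2) / wallRate y ^ 12 + (15 * y + 3 * y ^ 2) / wallRate y ^ 14 + (38 * y + 11 * y ^ 2) / wallRate y ^ 16 +
        (34 * y ^ 2 + y ^ 3) / wallRate y ^ 18 + 7 * y ^ 3 / wallRate y ^ 20 ≤
      ∑ k ∈ range 11, pwbLaw y k := by
  classical
  have hβ := wallRate_pos y
  have e0 : pwbLaw y 0 = 0 := pwbLaw_zero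
  have e2 : pwbLaw y 2 = 0 := by rw [pwbLaw_eq_khs 2 (m := 4) rfl, IPWB_four rfl, zero_div]
  have e3 : pwbLaw y 3 = y / wallRate y ^ 6 := by rw [pwbLaw_eq_khs 3 (m := 6) rfl, IPWB_six rfl]
  have e4 : pwbLaw y 4 = y / wallRate y ^ 8 := by rw [pwbLaw_eq_khs 4 (m := 8) rfl, IPWB_eight_eq rfl]
  have e5 : pwbLaw y 5 = 3 * y / wallRate y ^ 10 := by rw [pwbLaw_eq_khs 5 (m := 10) rfl, IPWB_ten_eq rfl]
  have e6 : pwbLaw y 6 = (6 * y + y ^ 2) / wallRate y ^ 12 := by rw [pwbLaw_eq_khs 6 (m := 12) rfl, IPWB_twelve_eq_six rfl]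
  have e7 : pwbLaw y 7 = (15 * y + 3 * y ^ 2) / wallRate y ^ 14 := by rw [pwbLaw_eq_khs 7 (m := 14) rfl, IPWB_fourteen_eq_fifteen rfl]
  have e8 : pwbLaw y 8 = (38 * y + 11 * y ^ 2) / wallRate y ^ 16 := by rw [pwbLaw_eq_khs 8 (m := 16) rfl, IPWB_sixteen_eq_thirtyEight rfl]
  have e9 : (34 * y ^ 2 + y ^ 3) / wallRate y ^ 18 ≤ pwbLaw y 9 := by
    rw [pwbLaw_eq_khs 9 (m := 18) rfl, IPWB_eighteen_eq rfl]
    refine div_le_div_of_nonneg_right ?_ (pow_pos hβ 18).le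
    have hN : (0 : ℝ) ≤ #((ipwb 18).filter fun ω => visits 18 ω = 1) * y := mul_nonneg (Nat.cast_nonneg _) hy.le
    linarith
  have e10 : 7 * y ^ 3 / wallRate y ^ 20 ≤ pwbLaw y 10 := by
    rw [pwbLaw_eq_khs 10 (m := 20) rfl, IPWB_twenty_eq rfl]
    refine div_le_div_of_nonneg_right ?_ (pow_pos hβ 20).le
    have hN1 : (0 : ℝ) ≤ #((ipwb 20).filter fun ω => visits 20 ω = 1) * y := mul_nonneg (Nat.cast_nonneg _) hy.le
    have hN2 : (0 : ℝ) ≤ #((ipwb 20).filter fun ω => visits 20 ω = 2) * y ^ 2 := mul_nonneg (Nat.cast_nonneg _) (pow_nonneg hy.le 2)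
    linarith
  have e1 := div_sq_wallRate_le_pwbLaw_one hy
  simp only [Finset.sum_range_succ, Finset.sum_range_zero, e0, e2, e3, e4, e5, e6, e7, e8]
  linarith

/-! ## 3. Kesten's identity: partial sums are at most one, and at least one minus the six-step tail -/

/-- `Σ_{k ≤ n} f_k(y) ≤ 1` for `y > μ³` (partial sums of Kesten's identity). [cite: MadrasSlade1993, §4.2, (4.2.4), Theorem 4.2.2 (pp. 91–92)] -/
theorem sum_pwbLaw_range_le_one_of_cube_lt (hy : hexConnectiveConstant ^ 3 < y) (n : ℕ) :
    ∑ k ∈ range n, pwbLaw y k ≤ 1 := by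
  have hμ := hexConnectiveConstant_pos
  have hy0 : 0 < y := lt_of_le_of_lt (by positivity) hy
  exact sum_le_hasSum (range n) (fun k _ => pwbLaw_nonneg hy0.le k) (hasSum_pwbLaw_of_cube_lt hy)

/-- ★ **The order-seven head sandwich** for `y > μ³`:
`1 − Aθ₃^{10} − 3^{18}y/β^{18} − 3^{20}(y + y²)/β^{20} ≤ H₇(y) ≤ 1`, `θ₃ = μ²/y^{2/3}`, `A = (μ² + y^{2/3}/μ²)θ₃/(1 − θ₃)`.
The monotone inversion of the left inequality in `β²` gives `a₆ ≤ 12`; the right one (equivalently car 70's floor) gives `a₆ ≥ 12`.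
[cite: MadrasSlade1993, §4.2, (4.2.2), (4.2.4), Theorem 4.2.2 (pp. 91–92)] [cite: Kesten1963SAW, §4] -/
theorem kesten_head_seven_sandwich_of_cube_lt (hy : hexConnectiveConstant ^ 3 < y) :
    1 - (hexConnectiveConstant ^ 2 + y ^ ((2 : ℝ) / 3) / hexConnectiveConstant ^ 2) *
          (hexConnectiveConstant ^ 2 / y ^ ((2 : ℝ) / 3)) / (1 - hexConnectiveConstant ^ 2 / y ^ ((2 : ℝ) / 3)) *
          (hexConnectiveConstant ^ 2 / y ^ ((2 : ℝ) / 3)) ^ 10 -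
        (3 ^ 18 * y / wallRate y ^ 18 + (3 ^ 20 * y + 3 ^ 20 * y ^ 2) / wallRate y ^ 20) ≤
      y / wallRate y ^ 2 + y / wallRate y ^ 6 + y / wallRate y ^ 8 + 3 * y / wallRate y ^ 10 +
        (6 * y + y ^ 2) / wallRate y ^ 12 + (15 * y + 3 * y ^ 2) / wallRate y ^ 14 + (38 * y + 11 * y ^ 2) / wallRate y ^ 16 +
        (34 * y ^ 2 + y ^ 3) / wallRate y ^ 18 + 7 * y ^ 3 / wallRate y ^ 20 ∧
    y / wallRate y ^ 2 + y / wallRate y ^ 6 + y / wallRate y ^ 8 + 3 * y / wallRate y ^ 10 +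
        (6 * y + y ^ 2) / wallRate y ^ 12 + (15 * y + 3 * y ^ 2) / wallRate y ^ 14 + (38 * y + 11 * y ^ 2) / wallRate y ^ 16 +
        (34 * y ^ 2 + y ^ 3) / wallRate y ^ 18 + 7 * y ^ 3 / wallRate y ^ 20 ≤ 1 := by
  have hμ := hexConnectiveConstant_pos
  have hy0 : 0 < y := lt_of_le_of_lt (by positivity) hy
  have htail := one_sub_sum_pwbLaw_le_of_cube_lt hy 10
  have hup := sum_pwbLaw_range_eleven_le hy0.le
  have hlow := head_le_sum_pwbLaw_range_eleven hy0
  have hone := sum_pwbLaw_range_le_one_of_cube_lt hy 11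
  have hsplit : (3 ^ 18 * y + 34 * y ^ 2 + y ^ 3) / wallRate y ^ 18 =
      3 ^ 18 * y / wallRate y ^ 18 + (34 * y ^ 2 + y ^ 3) / wallRate y ^ 18 := by ring
  have hsplit' : (3 ^ 20 * y + 3 ^ 20 * y ^ 2 + 7 * y ^ 3) / wallRate y ^ 20 =
      (3 ^ 20 * y + 3 ^ 20 * y ^ 2) / wallRate y ^ 20 + 7 * y ^ 3 / wallRate y ^ 20 := by ring
  rw [hsplit, hsplit'] at hup
  constructor
  · linarith
  · linarith


/-! ## 4. (ed.2) The order-seven-SHARP sandwich: tail at `n = 11`, the block `k = 11` bounded crudely -/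

/-- `Λ_m(y) ≤ 3^m (y + y² + y³)` for `m = 22`, `y ≥ 0` (symbolic length: every block of length `22` has `1 ≤ visits ≤ 3` by the
six-step law, and there are at most `3^{22}` blocks). [cite: MadrasSlade1993, §4.2, (4.2.2); §1.2, (1.2.16) (p. 11)] -/
theorem IPWB_twentytwo_le {m : ℕ} (hm : m = 22) (hy : 0 ≤ y) : IPWB m y ≤ 3 ^ m * (y + y ^ 2 + y ^ 3) := by
  classical
  have hterm : ∀ ω ∈ ipwb m, y ^ visits m ω ≤ y + y ^ 2 + y ^ 3 := by
    intro ω hω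
    have h1 := one_le_visits_of_mem_ipwb hω
    have h6 := six_mul_visits_le hω (by omega)
    have h3 : visits m ω ≤ 3 := by omega
    have hy2 : 0 ≤ y ^ 2 := pow_nonneg hy 2
    have hy3 : 0 ≤ y ^ 3 := pow_nonneg hy 3
    rcases Nat.lt_or_ge (visits m ω) 2 with hv | hv
    · have hv1 : visits m ω = 1 := by omega
      rw [hv1, pow_one]; linarith
    rcases Nat.lt_or_ge (visits m ω) 3 with hv' | hv'
    · have hv2 : visits m ω = 2 := by omega
      rw [hv2]; linarith
    · have hv3 : visits m ω = 3 := by omega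
      rw [hv3]; linarith
  calc IPWB m y = ∑ ω ∈ ipwb m, y ^ visits m ω := rfl
    _ ≤ ∑ _ω ∈ ipwb m, (y + y ^ 2 + y ^ 3) := Finset.sum_le_sum hterm
    _ = #(ipwb m) * (y + y ^ 2 + y ^ 3) := by rw [Finset.sum_const, nsmul_eq_mul]
    _ ≤ 3 ^ m * (y + y ^ 2 + y ^ 3) := mul_le_mul_of_nonneg_right (card_ipwb_le_three_pow m) (by positivity)

/-- `f₁₁(y) ≤ 3^{22}(y + y² + y³)/β(y)^{22}` for `y ≥ 0`. [cite: MadrasSlade1993, §4.2, (4.2.2); §1.2, (1.2.16) (p. 11)] -/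
theorem pwbLaw_eleven_le (hy : 0 ≤ y) : pwbLaw y 11 ≤ 3 ^ 22 * (y + y ^ 2 + y ^ 3) / wallRate y ^ 22 := by
  obtain ⟨m, hm⟩ : ∃ m : ℕ, m = 22 := ⟨_, rfl⟩
  have e : pwbLaw y 11 = IPWB m y / wallRate y ^ m := by rw [pwbLaw, hm]
  have h := IPWB_twentytwo_le hm hy
  rw [hm] at h
  rw [e, hm]
  exact div_le_div_of_nonneg_right h (pow_pos (wallRate_pos y) 22).le

/-- ★★ **The order-seven-SHARP head sandwich** for `y > μ³`:
`1 − Aθ₃^{11} − 3^{18}y/β^{18} − 3^{20}(y + y²)/β^{20} − 3^{22}(y + y² + y³)/β^{22} ≤ H₇(y) ≤ 1`, with the tail now `Aθ₃^{11} ≍ y^{−22/3} = o(y^{−7})`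
and all three correction terms `O(y^{−8})` — the inequality whose monotone inversion in `β²` yields `a₆ = 12`.
[cite: MadrasSlade1993, §4.2, (4.2.2), (4.2.4), Theorem 4.2.2 (pp. 91–92)] [cite: Kesten1963SAW, §4] -/
theorem kesten_head_seven_sandwich_sharp_of_cube_lt (hy : hexConnectiveConstant ^ 3 < y) :
    1 - (hexConnectiveConstant ^ 2 + y ^ ((2 : ℝ) / 3) / hexConnectiveConstant ^ 2) *
          (hexConnectiveConstant ^ 2 / y ^ ((2 : ℝ) / 3)) / (1 - hexConnectiveConstant ^ 2 / y ^ ((2 : ℝ) / 3)) *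
          (hexConnectiveConstant ^ 2 / y ^ ((2 : ℝ) / 3)) ^ 11 -
        (3 ^ 18 * y / wallRate y ^ 18 + (3 ^ 20 * y + 3 ^ 20 * y ^ 2) / wallRate y ^ 20 +
          3 ^ 22 * (y + y ^ 2 + y ^ 3) / wallRate y ^ 22) ≤
      y / wallRate y ^ 2 + y / wallRate y ^ 6 + y / wallRate y ^ 8 + 3 * y / wallRate y ^ 10 +
        (6 * y + y ^ 2) / wallRate y ^ 12 + (15 * y + 3 * y ^ 2) / wallRate y ^ 14 + (38 * y + 11 * y ^ 2) / wallRate y ^ 16 +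
        (34 * y ^ 2 + y ^ 3) / wallRate y ^ 18 + 7 * y ^ 3 / wallRate y ^ 20 ∧
    y / wallRate y ^ 2 + y / wallRate y ^ 6 + y / wallRate y ^ 8 + 3 * y / wallRate y ^ 10 +
        (6 * y + y ^ 2) / wallRate y ^ 12 + (15 * y + 3 * y ^ 2) / wallRate y ^ 14 + (38 * y + 11 * y ^ 2) / wallRate y ^ 16 +
        (34 * y ^ 2 + y ^ 3) / wallRate y ^ 18 + 7 * y ^ 3 / wallRate y ^ 20 ≤ 1 := by
  have hμ := hexConnectiveConstant_pos
  have hy0 : 0 < y := lt_of_le_of_lt (by positivity) hy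
  have htail := one_sub_sum_pwbLaw_le_of_cube_lt hy 11
  have hup := sum_pwbLaw_range_eleven_le hy0.le
  have h11 := pwbLaw_eleven_le hy0.le
  have hone := (kesten_head_seven_sandwich_of_cube_lt hy).2
  have hsplit : (3 ^ 18 * y + 34 * y ^ 2 + y ^ 3) / wallRate y ^ 18 =
      3 ^ 18 * y / wallRate y ^ 18 + (34 * y ^ 2 + y ^ 3) / wallRate y ^ 18 := by ring
  have hsplit' : (3 ^ 20 * y + 3 ^ 20 * y ^ 2 + 7 * y ^ 3) / wallRate y ^ 20 =
      (3 ^ 20 * y + 3 ^ 20 * y ^ 2) / wallRate y ^ 20 + 7 * y ^ 3 / wallRate y ^ 20 := by ring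
  rw [hsplit, hsplit'] at hup
  have h12 : ∑ k ∈ range (11 + 1), pwbLaw y k = ∑ k ∈ range 11, pwbLaw y k + pwbLaw y 11 := Finset.sum_range_succ _ 11
  rw [h12] at htail
  exact ⟨by linarith, hone⟩

end Literature.Probability.RandomPlanarGeometry.SAW.HexBW.Wall

end
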